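import Summits.BirchSwinnertonDyer.Rank1Residual.Additive.X3BranchThreeLineCertificate
import HarnessLib

/-!
# X3 on the semistable-twist locus at `p = 3`: the per-pair LINE DATUM of the `p = 3` end state as ONE
# predicate `X3LineDatumThree W`, and its kernel certificate `(x₀, D, s)` — cell `bsd-addord`, seat
# `bsd-addord-twist` (strategy = twist transport); the vehicle of the per-pair records
# `X3ThreeLineDatumRecords*.lean` (B-X3G (iv) booking list, planner TARGET v5.5 §8 / v6.2 §8)

HONEST FRAMING (cell `bsd-addord`, `run/shared/lean/pub/bsd-addord/README.md` §4): the programme's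
target of record is the full Birch–Swinnerton-Dyer formula for every `E/ℚ` of analytic rank `≤ 1`;
this file is a TOOL. ONE definition (a predicate on `W`, nothing asserted) and theorems; no named
fact, no `sorry`; nothing is booked.

## What

* `X3LineDatumThree W` — the conjunction of the four per-pair line hypotheses of the `p = 3` end-state
  theorems `ClassX3Gord.{missingLowerBoundAt,bsdp}_three_rankZero_of_facts_of_nonAnomalous`
  (`X3BranchGordEndStateThreeOfLiftingFact.lean`) and `…_of_facts_of_lifting_of_nonAnomalous`
  (`X3BranchGordEndStateThreeOfFacts.lean`): SOME rational `3`-line `Φ₀ ≤ W[3]` which is EVEN, carries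
  a NON-TRIVIAL `Γ_ℚ`-action, and whose `χ_K`-twist is RAMIFIED at `3` for every quadratic field
  `K ∋ θ`, `θ² = −3` (Greenberg–Vatsal's line `Φ` of §2 p. 28 in the branch-parity position of the
  additive curve `W = E`).
* `exists_lineDatum_three_of_cert'` — the SHARPER certificate `(x₀, D, s)`: `Ψ₃(x₀) = 0`, `D`
  squarefree, `s ≠ 0`, `D·s² = Ψ₂Sq(x₀)`, `0 < D`, `D ≠ 1`, `3 ∤ D`. Compared with
  `exists_lineDatum_three_of_cert` the odd prime factor `q ∣ D` is replaced by `D ≠ 1`: the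
  `Γ_ℚ`-action on the line with kernel character `χ_D` is non-trivial as soon as `D` is not a square
  (the fixed field of `Γ_ℚ` on `ℚ̄` is `ℚ`, Mathlib `InfiniteGalois.mem_range_algebraMap_iff_fixed`),
  which covers the kernel discriminant `D = 2` (90 of the 685 rank-`0` classes of the booking list).
* `x3LineDatumThree_of_cert'` / `x3LineDatumThree_of_cert_of_delta` — the predicate from the
  certificate; the `_of_delta` form takes a concrete model with `Δ ≠ 0` and the numerals first
  (pattern of `X2.CellACertN9.gvPar_three_of_cert_of_delta`).
* `exists_lineHypotheses_of_x3LineDatumThree` — unfolding, in the binder shape the end states consume.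

References: [GreenbergVatsal2000] §2 p. 28 (the line `Φ` and its character); [SilvermanAEC2009]
Ex. 3.7 (`Ψ₃`, `Ψ₂²`); [Lang1983] Ch. 6 Prop. 1.3 (Kummer character on inertia).
-/

set_option autoImplicit false

noncomputable section

open scoped Classical NumberField

namespace Summit.BirchSwinnertonDyer.Rank1Residual.Additive

open WeierstrassCurve Polynomial NumberField IsDedekindDomain Field
  Literature.NumberTheory.GaloisRepresentations
  Literature.NumberTheory.EllipticCurves
  Literature.NumberTheory.EllipticCurves.Rank1Residual
  Summit.BirchSwinnertonDyer.Rank1Residual.GaloisImage.RamifiedOrdinaryLineTwist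

/-- **The `p = 3` line datum of the X3♯(G-ord, `e = 2`) end state.** For a Weierstrass curve `W/ℚ`:
there is a rational `3`-line `Φ₀ ≤ W[3]` (`IsRationalLine W 3 Φ₀`) which is EVEN (`LineEven W 3 Φ₀`),
on which `Γ_ℚ` acts NON-trivially (`∃ σ P, P ∈ Φ₀ ∧ σ • P ≠ P`), and whose `χ_K`-twist is RAMIFIED at
`3` for every quadratic number field `K` containing a square root of `−3` (for some place `v ∣ 3`,
prime `𝔓 ∣ v` of `ℚ̄` and inertia element `σ`, `σ • P ≠ χ_K(σ) • P` for some `P ∈ Φ₀`). In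
Greenberg–Vatsal's notation: `W[3] ⊇ Φ` with character `φ = χ_D`, `D > 0` squarefree, `D ≠ 1`,
`3 ∤ D`. A predicate on `W`; nothing asserted. [cite: GreenbergVatsal2000, §2 p. 28 (the subgroup Φ and its character φ)] -/
def X3LineDatumThree (W : WeierstrassCurve ℚ) : Prop :=
  ∃ Φ₀ : AddSubgroup (W.geomTorsion ((3 : ℕ) : ℤ)), IsRationalLine W 3 Φ₀ ∧ LineEven W 3 Φ₀ ∧
    (∃ (σ : absoluteGaloisGroup ℚ) (P : W.geomTorsion ((3 : ℕ) : ℤ)), P ∈ Φ₀ ∧ σ • P ≠ P) ∧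
    ∀ (K : Type) [Field K] [NumberField K] [(galRange (K := ℚ) K).Normal],
      Module.finrank ℚ K = 2 →
      (∃ θ : K, θ ^ 2 = algebraMap ℚ K ((-1) ^ ((3 : ℕ) / 2) * (3 : ℕ))) →
      ¬ ∀ v : HeightOneSpectrum (𝓞 ℚ), (((3 : ℕ) : ℕ) : 𝓞 ℚ) ∈ v.asIdeal →
        ∀ 𝔓 ∈ v.primesAbove, ∀ σ ∈ 𝔓.inertia (absoluteGaloisGroup ℚ), ∀ P ∈ Φ₀,
          σ • P = (if σ ∈ galRange (K := ℚ) K then P else -P)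

/-- Unfolding `X3LineDatumThree W` into the four binders `Φ₀, hΦ, heven, hnt, hram` consumed by the
`p = 3` end-state theorems. [folklore] -/
theorem exists_lineHypotheses_of_x3LineDatumThree {W : WeierstrassCurve ℚ} (h : X3LineDatumThree W) :
    ∃ Φ₀ : AddSubgroup (W.geomTorsion ((3 : ℕ) : ℤ)), IsRationalLine W 3 Φ₀ ∧ LineEven W 3 Φ₀ ∧
      (∃ (σ : absoluteGaloisGroup ℚ) (P : W.geomTorsion ((3 : ℕ) : ℤ)), P ∈ Φ₀ ∧ σ • P ≠ P) ∧
      ∀ (K : Type) [Field K] [NumberField K] [(galRange (K := ℚ) K).Normal],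
        Module.finrank ℚ K = 2 →
        (∃ θ : K, θ ^ 2 = algebraMap ℚ K ((-1) ^ ((3 : ℕ) / 2) * (3 : ℕ))) →
        ¬ ∀ v : HeightOneSpectrum (𝓞 ℚ), (((3 : ℕ) : ℕ) : 𝓞 ℚ) ∈ v.asIdeal →
          ∀ 𝔓 ∈ v.primesAbove, ∀ σ ∈ 𝔓.inertia (absoluteGaloisGroup ℚ), ∀ P ∈ Φ₀,
            σ • P = (if σ ∈ galRange (K := ℚ) K then P else -P) :=
  h

/-- **The line datum from the kernel certificate `(x₀, D, s, q)`** of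
`exists_lineDatum_three_of_cert` (`q` an odd prime factor of `D`). [folklore] -/
theorem x3LineDatumThree_of_cert {W : WeierstrassCurve ℚ} [W.IsElliptic] {x₀ s : ℚ} {D : ℤ}
    (hψ : W.Ψ₃.eval x₀ = 0) (hsq : Squarefree D) (hs : s ≠ 0)
    (hDs : (D : ℚ) * s ^ 2 = W.Ψ₂Sq.eval x₀) (hpos : 0 < D)
    (q : ℕ) [Fact q.Prime] (hq2 : q ≠ 2) (hqD : (q : ℤ) ∣ D) (h3D : ¬ (3 : ℤ) ∣ D) :
    X3LineDatumThree W :=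
  exists_lineDatum_three_of_cert hψ hsq hs hDs hpos q hq2 hqD h3D

/-! ### The sharper certificate: `D ≠ 1` in place of an odd prime factor -/

/-- **Some `σ ∈ Γ_F` moves `√d` when `d ∈ F` is not a square** (`F` perfect): otherwise
`√d ∈ F̄^{Γ_F} = F` (`F̄/F` is Galois; Mathlib `InfiniteGalois.mem_range_algebraMap_iff_fixed`), so
`d = r²` with `r ∈ F`. Stated for a general perfect field to stay clear of the two `ℚ`-algebra
structures on `ℚ̄`; used at `F = ℚ`. [folklore] -/
theorem exists_smul_geomSqrt_ne_of_not_isSquare {F : Type*} [Field F] [PerfectField F] {d : F}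
    (hd : ¬ IsSquare d) : ∃ σ : absoluteGaloisGroup F, σ • geomSqrt d ≠ geomSqrt d := by
  by_contra h
  push Not at h
  have hfix : ∀ e : AlgebraicClosure F ≃ₐ[F] AlgebraicClosure F, e (geomSqrt d) = geomSqrt d :=
    fun e ↦ by
      have he := h ((absoluteGaloisGroup.toAlgEquiv F).symm e)
      rwa [absoluteGaloisGroup.toAlgEquiv_symm_apply] at he
  obtain ⟨r, hr⟩ := (InfiniteGalois.mem_range_algebraMap_iff_fixed (geomSqrt d)).mpr hfix
  apply hd
  refine ⟨r, (algebraMap F (AlgebraicClosure F)).injective ?_⟩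
  rw [map_mul, hr, ← sq, geomSqrt_sq]

/-- A squarefree integer other than `1` is not a rational square (`D = r²` with `r` a unit forces
`D = 1`).
[folklore] -/
theorem not_isSquare_ratCast_of_squarefree {D : ℤ} (hsq : Squarefree D) (hD1 : D ≠ 1) :
    ¬ IsSquare (D : ℚ) := by
  rw [Rat.isSquare_intCast_iff]
  rintro ⟨r, hr⟩
  have hu : IsUnit r := hsq r ⟨1, by rw [hr, mul_one]⟩
  rcases Int.isUnit_iff.mp hu with h1 | h1 <;> exact hD1 (by rw [hr, h1]; norm_num)

variable {W : WeierstrassCurve ℚ} [W.IsElliptic]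

/-- **Per-pair certificate of the `p = 3` line datum, sharper form.** `Ψ₃(x₀) = 0`, `D` squarefree,
`s ≠ 0`, `D·s² = Ψ₂Sq(x₀)`, `0 < D`, `D ≠ 1` and `3 ∤ D` give a rational `3`-line `Φ₀ ≤ W[3]`
(kernel character `χ_D`, `KernelDisc.exists_isRationalLine_kernelChar_of_cert`) which is EVEN
(`0 < D`), carries a NON-TRIVIAL `Γ_ℚ`-action (`D` is not a square) and whose `χ_K`-twist is
RAMIFIED at `3` for every quadratic `K` with `θ² = −3` (`3 ∤ D`: inertia at `3` fixes `√D` but some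
inertia element negates `√−3`) — the four line hypotheses of the `p = 3` end-state theorems. The
ramification half of the proof is that of `exists_lineDatum_three_of_cert` verbatim. [folklore] -/
theorem exists_lineDatum_three_of_cert' [hp : Fact (Nat.Prime 3)] {x₀ s : ℚ} {D : ℤ}
    (hψ : W.Ψ₃.eval x₀ = 0) (hsq : Squarefree D) (hs : s ≠ 0)
    (hDs : (D : ℚ) * s ^ 2 = W.Ψ₂Sq.eval x₀) (hpos : 0 < D) (hD1 : D ≠ 1) (h3D : ¬ (3 : ℤ) ∣ D) :
    ∃ Φ₀ : AddSubgroup (geomTorsion W ((3 : ℕ) : ℤ)), IsRationalLine W 3 Φ₀ ∧ LineEven W 3 Φ₀ ∧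
      (∃ (σ : absoluteGaloisGroup ℚ) (P : W.geomTorsion ((3 : ℕ) : ℤ)), P ∈ Φ₀ ∧ σ • P ≠ P) ∧
      ∀ (K : Type) [Field K] [NumberField K] [(galRange (K := ℚ) K).Normal],
        Module.finrank ℚ K = 2 →
        (∃ θ : K, θ ^ 2 = algebraMap ℚ K ((-1) ^ ((3 : ℕ) / 2) * (3 : ℕ))) →
        ¬ ∀ v : HeightOneSpectrum (𝓞 ℚ), (((3 : ℕ) : ℕ) : 𝓞 ℚ) ∈ v.asIdeal →
          ∀ 𝔓 ∈ v.primesAbove, ∀ σ ∈ 𝔓.inertia (absoluteGaloisGroup ℚ), ∀ P ∈ Φ₀,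
            σ • P = (if σ ∈ galRange (K := ℚ) K then P else -P) := by
  have hD0 : D ≠ 0 := hsq.ne_zero
  obtain ⟨Φ, hΦ, hχ⟩ := KernelDisc.exists_isRationalLine_kernelChar_of_cert hψ hD0 hs hDs
  -- a non-zero point of the line
  haveI : Finite Φ := Nat.finite_of_card_ne_zero (by rw [hΦ.1]; decide)
  haveI : Nontrivial Φ := Finite.one_lt_card_iff_nontrivial.mp (by rw [hΦ.1]; decide)
  obtain ⟨⟨P₀, hP₀⟩, hP₀ne⟩ := exists_ne (0 : Φ)
  have hP₀0 : P₀ ≠ 0 := fun h ↦ hP₀ne (Subtype.ext h)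
  refine ⟨Φ, hΦ, KernelDisc.lineEven_of_pos hχ hpos, ?_, ?_⟩
  · -- non-trivial action: `D` is not a square, so some `σ` moves `√D`, hence moves `P₀`
    have hnsq : ¬ IsSquare (D : ℚ) :=
      not_isSquare_ratCast_of_squarefree hsq hD1
    obtain ⟨σ, hσ⟩ := exists_smul_geomSqrt_ne_of_not_isSquare hnsq
    refine ⟨σ, P₀, hP₀, fun hfix ↦ hσ ?_⟩
    have hall : ∀ Q ∈ Φ, σ • Q = Q := (KernelDisc.forall_smul_eq_iff_of_mem hΦ hP₀ hP₀0 σ).mpr hfix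
    exact (hχ σ).mp hall
  · -- the `χ_K`-twist is ramified at `3`: an inertia element at `3` fixes `Φ` but negates `√−3`
    intro K _ _ _ h2K hθ hall
    obtain ⟨θ, hθ⟩ := hθ
    obtain ⟨v, hv⟩ :=
      Literature.NumberTheory.NumberFields.RingOfIntegers.exists_heightOneSpectrum_natCast_mem ℚ hp.out
    obtain ⟨σ, hσI, hσneg⟩ := exists_mem_absInertia_smul_geomSqrt_pStar_eq_neg 3 (by decide) hv
    set τ : absoluteGaloisGroup ℚ := absGaloisRestrict ℚ (v.adicCompletion ℚ) σ with hτ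
    have hτI : τ ∈ (adicCompletionPrime ℚ v).inertia (absoluteGaloisGroup ℚ) := by
      rw [inertia_adicCompletionPrime_eq_map_absInertia]
      exact Subgroup.mem_map.2 ⟨σ, hσI, rfl⟩
    -- `τ` fixes `√D` (`3 ∤ 4D`), hence `Φ` pointwise
    have hfixD : τ • geomSqrt ((D : ℤ) : ℚ) = geomSqrt ((D : ℤ) : ℚ) :=
      smul_geomSqrt_eq_of_mem_inertia (p := 3) (not_dvd_four_mul (by decide) h3D) hv
        (adicCompletionPrime_mem_primesAbove ℚ v) hτI
    have hfixΦ : τ • P₀ = P₀ := (hχ τ).mpr hfixD P₀ hP₀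
    -- `τ ∉ galRange K`: it negates `j(θ) = ±√−3`
    have hsqθ := embIntoClosure_sq K hθ
    have hsqr := geomSqrt_sq ((-1 : ℚ) ^ ((3 : ℕ) / 2) * (3 : ℕ))
    have hpm : embIntoClosure (K := ℚ) K θ = geomSqrt ((-1 : ℚ) ^ ((3 : ℕ) / 2) * (3 : ℕ)) ∨
        embIntoClosure (K := ℚ) K θ = -geomSqrt ((-1 : ℚ) ^ ((3 : ℕ) / 2) * (3 : ℕ)) := by
      exact sq_eq_sq_iff_eq_or_eq_neg.mp (hsqθ.trans hsqr.symm)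
    have hr0 : geomSqrt ((-1 : ℚ) ^ ((3 : ℕ) / 2) * (3 : ℕ)) ≠
        -geomSqrt ((-1 : ℚ) ^ ((3 : ℕ) / 2) * (3 : ℕ)) := geomSqrt_ne_neg (by norm_num)
    have hτK : τ ∉ galRange (K := ℚ) K := by
      apply not_mem_galRange_of_smul_embIntoClosure_ne K
      rcases hpm with h | h
      · rw [h, hσneg]
        exact fun e ↦ hr0 e.symm
      · rw [h, smul_neg, hσneg, neg_neg]
        exact hr0
    -- contradiction: `τ • P₀ = -P₀` by `hall`, but `τ` fixes `P₀ ≠ 0`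
    have hτP := hall v hv (adicCompletionPrime ℚ v) (adicCompletionPrime_mem_primesAbove ℚ v) τ hτI
      P₀ hP₀
    rw [if_neg hτK, hfixΦ] at hτP
    -- `P₀ = -P₀` with `3 • P₀ = 0` forces `P₀ = 0`
    apply hP₀0
    refine X2.ResidualDevissageLine.eq_zero_of_two_nsmul_eq_zero (by decide) P₀
      (X2.ResidualDevissageLine.nsmul_eq_zero_of_mem_geomTorsion P₀) ?_
    rw [two_nsmul]
    nth_rewrite 2 [hτP]
    exact add_neg_cancel P₀

/-- The predicate from the sharper certificate. [folklore] -/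
theorem x3LineDatumThree_of_cert' [Fact (Nat.Prime 3)] {x₀ s : ℚ} {D : ℤ}
    (hψ : W.Ψ₃.eval x₀ = 0) (hsq : Squarefree D) (hs : s ≠ 0)
    (hDs : (D : ℚ) * s ^ 2 = W.Ψ₂Sq.eval x₀) (hpos : 0 < D) (hD1 : D ≠ 1) (h3D : ¬ (3 : ℤ) ∣ D) :
    X3LineDatumThree W :=
  exists_lineDatum_three_of_cert' hψ hsq hs hDs hpos hD1 h3D

omit [W.IsElliptic] in
/-- **The line datum for a CONCRETE model** `W = ⟨a₁, a₂, a₃, a₄, a₆⟩` with `Δ ≠ 0` from the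
certificate `(x₀, s, D)` — the shape used by the per-pair records (numerals first, then the
`norm_num` / `decide` obligations: `Ψ₃(x₀) = 0`, `D` squarefree, `s ≠ 0`, `D·s² = Ψ₂Sq(x₀)`,
`0 < D`, `D ≠ 1`, `3 ∤ D`). [folklore] -/
theorem x3LineDatumThree_of_cert_of_delta (W : WeierstrassCurve ℚ) (hΔ : W.Δ ≠ 0)
    (x₀ s : ℚ) (D : ℤ)
    (hψ : W.Ψ₃.eval x₀ = 0) (hsq : Squarefree D) (hs : s ≠ 0)
    (hDs : (D : ℚ) * s ^ 2 = W.Ψ₂Sq.eval x₀) (hpos : 0 < D) (hD1 : D ≠ 1) (h3D : ¬ (3 : ℤ) ∣ D) :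
    X3LineDatumThree W := by
  haveI : W.IsElliptic := ⟨isUnit_iff_ne_zero.mpr hΔ⟩
  exact x3LineDatumThree_of_cert' hψ hsq hs hDs hpos hD1 h3D

end Summit.BirchSwinnertonDyer.Rank1Residual.Additive

end
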